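import Summits.CriticalPhenomena.CardyFormulaZ2.Theorems.CardyBondTriangularBondTriangularCardyKiteBStep
import HarnessLib

/-!
# Route CardyBondTriangular · crux `BondTriangularCardy` · line `birth`: the kite interface is reversible; stopping at `A₀` (theorems only)

Helper of the stub `stub_blueArm`. The successor of the kite interface (`…KiteBDarts`) is
injective on interface darts: following the interface of the complementary colouring backwards
undoes a step (`rev_succ_compl`) — Bollobás–Riordan's "every vertex of `I` has in- and out-degree at
most one" (p. 170) at the level of kites, where it rests on the no-alternation rule at edge
midpoints. Also: the finite set of darts along which the walk from a face of `G` moves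
(`exists_finset_of_darts`), and **the stopping rule**: when the left kite of the next dart belongs to an outer
hexagon, it is blue, i.e. seen across a dart of the stretch `A₀`, so the current left cell lies on
the arc `A₀` (`leftCell_mem_arc_zero_of_stop`).

## References

* B. Bollobás, O. Riordan, *Percolation*, CUP (2006), Ch. 7, Lemma 5 p. 170, Claim 10 p. 178.
-/

namespace Summit.CriticalPhenomena.CardyFormulaZ2.Theorems.BondTriangularCardyLine.KiteB

open Literature.Probability.Percolation Literature.Probability.LatticeModels
open RemovableAt (hexFaceVertices_leftFaceDir leftFaceDir_injective)
open TriMarkedDomain (fin3_add_one_add_one fin3_add_two_add_one fin3_add_two_add_two fin3_add_one_add_two)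

/-! ### The predecessor: a step of the complementary interface, backwards -/

section Pred

variable {D : TriMarkedDomain 3} {σ : CLHexConfig}

/-- The complementary colouring read at a cell. -/
theorem kc_compl (x : Site 2) (F : HexVertex) :
    kc (fun F j => !kcol D σ F j) x F = !ccol D σ x F := rfl

/-- **A step of the interface is undone by a step of the complementary interface taken
backwards** (for an admissible interface dart whose left cell is in `G`): the interface has
in-degree at most one. -/
theorem rev_succ_compl {d : KDart} (hd : iface (kcol D σ) d = true) (hadm : d.adm = true) (hG : d.leftCell ∈ D.verts) :
    (succ (fun F j => !kcol D σ F j) (succ (kcol D σ) d).rev).rev = d := by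
  rw [iface_iff'] at hd
  obtain ⟨hl, hr⟩ := hd
  cases d with
  | toMid F j =>
    simp only [KDart.leftCell, KDart.rightCell, KDart.leftCorner, KDart.rightCorner, ccol_faceVertex] at hl hr hG
    have hne : F ≠ oppFace F j := (hexGraph_adj_oppFace F j).ne
    have m1 : faceVertex F (j + 2) ∈ hexFaceVertices (oppFace F j) := faceVertex_oppFace_succ F j ▸ faceVertex_mem _ _
    have m2 : faceVertex F (j + 1) ∈ hexFaceVertices (oppFace F j) := faceVertex_oppFace_succ_succ F j ▸ faceVertex_mem _ _
    simp only [succ]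
    split_ifs with h1 h2
    · -- turned left into the left cell
      rw [kcol_oppIdx_succ] at h1
      have c : ccol D σ (faceVertex F (j + 1)) (oppFace F j) = true :=
        noAlt (adj_exitDart F j) (Or.inl hG) hne (faceVertex_mem _ _) (faceVertex_mem _ _) m1 m2
          (by rw [ccol_faceVertex]; exact hl) h1 (by rw [ccol_faceVertex]; exact hr)
      simp only [KDart.rev, kc_compl, leftFace_faceVertex_rev, leftFace_succ_succ, c, ccol_faceVertex, hr,
        Bool.not_true, kidx_faceVertex, fin3_add_one_add_two]
      simp
    · simp only [KDart.rev, oppFace_oppFace, oppIdx_oppFace, Bool.not_eq_true', hl, hr]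
      simp
    · simp only [KDart.rev, kc_compl, leftFace_succ_succ, ccol_faceVertex, hl, Bool.not_false,
        kidx_faceVertex, fin3_add_one_add_two]
      simp
  | fromMid F j =>
    simp only [KDart.leftCell, KDart.rightCell, KDart.leftCorner, KDart.rightCorner, ccol_faceVertex] at hl hr
    simp only [succ]
    split_ifs with h1
    · simp only [KDart.rev, hr, Bool.not_true, fin3_add_two_add_one]
      simp
    · simp only [KDart.rev, hl, Bool.not_false, fin3_add_one_add_two]
      simp
  | toCtr x y =>
    simp only [succ, KDart.rev]
    congr 1; abel
  | fromCtr x y =>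
    simp only [KDart.leftCell, KDart.rightCell, KDart.leftCorner, KDart.rightCorner] at hl hr hG
    have h := (KDart.adm_fromCtr x y).1 hadm
    obtain ⟨hx, hy⟩ := faceVertex_kidx_leftFace h
    obtain ⟨hy', hx'⟩ := faceVertex_kidx_leftFace h.symm
    obtain ⟨m1, m2, m3, m4⟩ := mem_leftFace_four h
    have o1 := oppFace_leftFace h
    have o2 := oppFace_leftFace h.symm
    simp only [succ, kc_kcol]
    split_ifs with h1 h2
    · have c : ccol D σ y (leftFace y x) = true := noAlt h (Or.inl hG) (leftFace_ne_leftFace_rev h) m1 m2 m3 m4 hl hr h1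
      have k1 : kcol D σ (leftFace y x) (oppIdx (leftFace x y) (kidx (leftFace x y) x + 2) + 1) = true := by
        rw [← o1, kcol_oppIdx_succ, fin3_add_two_add_two, hy, o1]; exact c
      have k2 : kcol D σ (leftFace y x) (oppIdx (leftFace x y) (kidx (leftFace x y) x + 2) + 2) = true := by
        rw [← o1, kcol_oppIdx_succ_succ, fin3_add_two_add_one, hx, o1]; exact hr
      simp only [KDart.rev, o1, k1, k2, Bool.not_true, fin3_add_two_add_one, fin3_add_two_add_two, hx, hy]
      simp
    · simp only [KDart.rev, kc_compl, hr, hl, Bool.not_true, Bool.not_false]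
      simp
    · have k1 : kcol D σ (leftFace x y) (oppIdx (leftFace y x) (kidx (leftFace y x) y + 2) + 1) = false := by
        rw [← o2, kcol_oppIdx_succ, fin3_add_two_add_two, hx', o2]; exact hl
      simp only [KDart.rev, o2, k1, Bool.not_false, fin3_add_two_add_one, fin3_add_two_add_two, hx', hy']
      simp

/-- **The successor is injective on admissible interface darts with left cell in `G`.** -/
theorem succ_inj_of_iface {d d' : KDart} (hd : iface (kcol D σ) d = true) (hadm : d.adm = true) (hG : d.leftCell ∈ D.verts)
    (hd' : iface (kcol D σ) d' = true) (hadm' : d'.adm = true) (hG' : d'.leftCell ∈ D.verts)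
    (h : succ (kcol D σ) d = succ (kcol D σ) d') : d = d' := by
  rw [← rev_succ_compl hd hadm hG, h, rev_succ_compl hd' hadm' hG']

/-! ### Stopping at the arc `A₀` -/

/-- **Blue beyond a boundary dart means the stretch `A₀`** (registered anchor of this file). -/
theorem stretchIdx_zero_of_bdryCol_false : ∀ {D : Literature.Probability.Percolation.TriMarkedDomain 3} {n : ℕ}, D.bdryCol₃ n = false → D.stretchIdx₃ n = 0 := by
  intro D n h
  unfold TriMarkedDomain.bdryCol₃ TriMarkedDomain.bcolOf₃ at h
  simpa using h

/-- **The stopping rule**: if the left cell of the next dart is an outer hexagon then the current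
left cell lies on the arc `A₀` — the two left kites are blue at a common corner, and an outer kite
is blue exactly beyond a dart of the stretch `A₀`. -/
theorem leftCell_mem_arc_zero_of_next_out {d : KDart} (hd : iface (kcol D σ) d = true) (hadm : d.adm = true)
    (hG : d.leftCell ∈ D.verts) (hout : (succ (kcol D σ) d).leftCell ∉ D.verts) : d.leftCell ∈ D.arc 0 := by
  rcases leftCell_succ hd hadm with h | ⟨hadj, G, hy, ho, -, hc⟩
  · exact absurd (h ▸ hG) hout
  · rw [ccol_of_not_mem hout hG ho hy] at hc
    have hmem : (d.leftCell, (succ (kcol D σ) d).leftCell) ∈ triBdryDarts D.verts := mem_triBdryDarts.2 ⟨hG, hout, hadj⟩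
    have := D.iter_fst_mem_arc₃ (D.dpos (d.leftCell, (succ (kcol D σ) d).leftCell))
    rwa [D.iter_dpos hmem, stretchIdx_zero_of_bdryCol_false hc] at this

/-- Symmetrically, a right cell out of `G` is seen from the left cell (in `G`) across a yellow
boundary dart, of the stretch `A₁` or `A₂`; the dart is a half-edge. -/
theorem bdry_of_rightCell_out {d : KDart} (hd : iface (kcol D σ) d = true) (hadm : d.adm = true)
    (hG : d.leftCell ∈ D.verts) (hout : d.rightCell ∉ D.verts) :
    (d.leftCell, d.rightCell) ∈ triBdryDarts D.verts ∧ D.stretchIdx₃ (D.dpos (d.leftCell, d.rightCell)) ≠ 0 ∧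
      d.leftCorner = d.rightCorner := by
  rw [iface_iff'] at hd
  obtain ⟨-, hr⟩ := hd
  have key : triGraph.Adj d.leftCell d.rightCell ∧ d.leftCorner = d.rightCorner ∧
      d.leftCell ∈ hexFaceVertices d.rightCorner ∧ d.rightCell ∈ hexFaceVertices d.rightCorner := by
    cases d with
    | toMid F j => exact ⟨adj_exitDart F j, rfl, faceVertex_mem _ _, faceVertex_mem _ _⟩
    | fromMid F j => exact ⟨(adj_exitDart F j).symm, rfl, faceVertex_mem _ _, faceVertex_mem _ _⟩
    | toCtr x y => exact absurd hG hout
    | fromCtr x y => exact absurd hG hout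
  obtain ⟨hadj, hcor, m1, m2⟩ := key
  refine ⟨mem_triBdryDarts.2 ⟨hG, hout, hadj⟩, ?_, hcor⟩
  rw [ccol_of_not_mem hout hG m2 m1] at hr
  unfold TriMarkedDomain.bdryCol₃ TriMarkedDomain.bcolOf₃ at hr
  simpa using hr

end Pred

/-! ### The darts of the walk from a face of `G` are finitely many -/

/-- **Finiteness**: the admissible darts whose left cell is in `G` lie in a finite set. -/
theorem exists_finset_of_darts (D : TriMarkedDomain 3) :
    ∃ S : Finset KDart, ∀ d : KDart, d.adm = true → d.leftCell ∈ D.verts → d ∈ S := by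
  classical
  refine ⟨((triFacesTouching D.verts ×ˢ (Finset.univ : Finset (Fin 3))).image fun p => KDart.toMid p.1 p.2) ∪
    ((triFacesTouching D.verts ×ˢ (Finset.univ : Finset (Fin 3))).image fun p => KDart.fromMid p.1 p.2) ∪
    (D.verts.biUnion fun x => (triGraph.neighborFinset x).image (KDart.toCtr x)) ∪
    (D.verts.biUnion fun x => (triGraph.neighborFinset x).image (KDart.fromCtr x)), fun d hadm hG => ?_⟩
  simp only [Finset.mem_union, Finset.mem_image, Finset.mem_product, Finset.mem_univ, and_true, Finset.mem_biUnion,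
    SimpleGraph.mem_neighborFinset]
  cases d with
  | toMid F j => exact Or.inl (Or.inl (Or.inl ⟨(F, j), mem_triFacesTouching.2 ⟨_, hG, faceVertex_mem _ _⟩, rfl⟩))
  | fromMid F j => exact Or.inl (Or.inl (Or.inr ⟨(F, j), mem_triFacesTouching.2 ⟨_, hG, faceVertex_mem _ _⟩, rfl⟩))
  | toCtr x y => exact Or.inl (Or.inr ⟨x, hG, y, (KDart.adm_toCtr x y).1 hadm, rfl⟩)
  | fromCtr x y => exact Or.inr ⟨x, hG, y, (KDart.adm_fromCtr x y).1 hadm, rfl⟩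

end Summit.CriticalPhenomena.CardyFormulaZ2.Theorems.BondTriangularCardyLine.KiteB
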